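import Summits.QuantumFields.BalabanUV.Beta.FP.ConstrainedGhostIR
import Summits.QuantumFields.BalabanUV.Beta.FP.LatticeConvolutionBounds
import Mathlib.Analysis.Normed.Ring.InfiniteSum

/-!
# `BalabanUV.Beta.FP.ConstrainedGhostIRCoarse` — road «FP» for binder row D1, row H′2-IR ∕ IR-4a (owner ruling l.21173, 2026-08-20T20:43Z): THE COARSE
# HALF OF THE GHOST REMAINDER's SCALE-`N` SMOOTHNESS — from a DISPLAYED coarse-inverse letter (H-CINV) and the within-block oscillation letter (L1′)
# to leaf-06's multiplier letter (W): `|Ws(y,x′)| ≤ K·N⁻⁴·(‖y − quo N x′‖∞+1)⁻³`, `K` FREE of `N`; hence (T0)∕(T1) by leaf-06's `FP/ConstrainedGhostIR` interface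

HONEST DEPENDENCY (page 1, mandatory): continuum YM on T⁴ ⇐ BetaPertH ∧ nine spine estimates (0/9 proved); BetaPertH ⇐ (D1) ∧ (D4) ∧
CAP+tail; G-an2-4 gates asym, D1 and NE2/3/4.  HONEST FRAMING (cell contract, verbatim): «discharging `BetaPertH` makes Bałaban's UV
stability UNCONDITIONAL — a real constructive-QFT result; it is NOT the continuum limit and NOT the Clay problem.»  THIS MODULE is [folklore]
lattice power counting over leaf-06's `FP/ConstrainedGhost` (`coarse_woodbury`, `summable_Ws`, `abs_blockSum_free_le`) and `FP/ConstrainedGhostIR`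
(the (S)∕(W)-letter interface `abs_ghostRem_le_of_letters`, `abs_ghostRem_sub_le_of_letters`) and leaf-05-g9's `FP/LatticeConvolutionBounds`
(kernel ∘ profile sums) BY NAME; every analytic input is a DISPLAYED HYPOTHESIS with its supplier named; no `def`, no `def … : Prop`, nothing cited,
0 sorry.  It proves NO estimate of a Bałaban object unconditionally: (H-CINV) is supplied by the owner's `FP/CoarseInverseScalar` (IR-4b, pv23's
`qGqInv_decay_unif` + `actionKer` route, INTENT l.21264) — until that lands it is a hypothesis here.  0∕4 binders of row D1; NOT D1, NOT BetaPertH,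
NOT continuum, NOT Clay.

ABSOLUTE RULE (cell charter, verbatim): «No internally-minted statement may enter as a cited fact. Every hypothesis is either kernel-proved in
this package or a verbatim quotation of a PUBLISHED theorem with page reference. The manuscript(s) under audit are NOT citable for their own
disputed steps — they are the thing under adjudication; programme-internal (2001/route/tribunal) claims are never citable.»

OBJECTS (`d + 1 = 4`, block side `N ≥ 1`, an2's blocks `B(u) = N•u + box`, `box = {0,…,N−1}⁴`, `quo N x` = block index): `A(x,u) := blockSum N (G₀(x − ·)) u`
(`G₀ = latticeGreen∕2`), `M(v,w) := Σ_{b ∈ box} A(N•v + b, w)` (the UNNORMALISED coarse operator `Q′G₀Q′ᵀ` of `coarse_woodbury`; the owner's scaling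
check l.21173: `M = N⁸·Q_NG₀Q_Nᵀ`, so a coarse inverse is `N⁻⁸·G_C`, `|G_C| ≤ C·N²·e^{−δ‖·‖}` ⟺ `|C| ≤ c₀N⁻⁶e^{−δ‖·‖}`), an2's multiplier `Ws(u,x′)`.
LETTERS (hypotheses; suppliers): (H-CINV) a kernel `C` with `|C u v| ≤ κ∕(‖u−v‖∞+1)⁵` and `∀ u w, HasSum (fun v ↦ C u v · M v w) [u = w]` — the POLYNOMIAL
form, implied by the exponential one `c₀N⁻⁶e^{−δ‖u−v‖∞}` with `κ = c₀N⁻⁶·e^δ·5!∕δ⁵` (`LatticeConvolutionBounds.exp_neg_supNorm_le_div_pow`, §5)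
[owner, `FP/CoarseInverseScalar` (C1)–(C2)]; (L1′) the within-block oscillation `quo x = quo y ⟹ |A(x,v) − A(y,v)| ≤ a₂N²∕(‖quo x − v‖∞+1)³`
[IR-1-GEN (D1) `FP/BlockAveragedKernel.abs_blockSum_fwdDiff_le_profile` at `K := G₀` + `FP/LatticeTaylorPath.abs_taylor0D_le`; instance file];
(S)∕(S′) leaf-06's free-leg letters, passed through.
CONTENT. §1 algebra of `A`, `M` (`#box = N⁴`, evenness, **`coarseM_symm`**, boundedness); §2 **`Ws_eq_neg_tsum`**: `Ws(u,x′) = −Σ'_v C(u,v)·A(x′,v)` for ANY summable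
LEFT inverse `C` (Fubini); §3 **`W_add_delta_bound`** (THE CANCELLATION, the owner's (ε): «THE point of the row — H′2-IR's vector case reuses its shape
verbatim»): `|Ws(u,x′) + [u = quo x′]∕N⁴| ≤ 1296·κ·a₂N²∕(‖u − quo x′‖∞+1)³` — `Σ'_v C(u,v)M(v,u′) = [u = u′]` and `M(v,u′) = Σ_b A(N•u′+b, v)` make
`Ws + δ∕N⁴ = −C·(A − block average of A)`, a within-block DIFFERENCE, and a degree-5 kernel reproduces the degree-3 profile; §4 **`abs_Ws_le_of_coarseInv`**:
leaf-06's (W) letter with `b = 3`, `K = 1296κa₂N⁶ + 1` (`= 1296c₀a₂ + 1` at `κ = c₀N⁻⁶`, N-FREE); §5 (T0)∕(T1) UNDER (H-CINV): **`abs_ghostRem_le_of_coarseInv`**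
`|ghostRem N x x′| ≤ 162·A·(1296κa₂N⁶ + 1)·N⁻²` and **`abs_ghostRem_sub_le_of_coarseInv`** `≤ 162·A′·(…)·N⁻³`, by leaf-06's interface in two lines each;
`…_exp` variants from the exponential letter.  (T2-sup)∕(T2-win) (owner's re-scope: `log N` in sup, log-free windowed) are NOT here — they need IR-1's
(D2) marginal profile (`FP/BlockAveragedKernelDipole`) and follow in the letters-instance file.
Provenance: D1 formalisation swarm, unit b2b-balaban-beta-d1-formalise-leaf-05 gen 9 (prover-b2b-balaban-beta-d1-formalise-leaf-05-g9-0),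
2026-08-20; `LEAVES-FP.md` row H′2-IR ∕ IR-4a; seam with leaf-06 per l.21175∕l.21295 (sibling file, their interface imported BY NAME).
[folklore], 0 def, 0 cite, 0 sorry.
-/


namespace Summit.QuantumFields.BalabanUV.Beta.FP.ConstrainedGhostIRCoarse

open Filter Topology Finset
open scoped BigOperators
open Literature.Probability.LatticeModels (latticeGreen latticeGreen_neg)
open Literature.MathematicalPhysics.QuantumFieldTheory.Balaban1983to89.Beta
open AffineAveraging (box toSite blockSum unitVec)
open Literature.MathematicalPhysics.QuantumFieldTheory.LatticeForm (quo)
open KKTFluctuationEnergy (quo_zsmul_add_toSite)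
open ScalarBlockKKT (Ws)
open Literature.MathematicalPhysics.QuantumFieldTheory.Balaban1983to89.Beta.DyadicShell (Pt supNorm supNorm_eq_zero_iff)
open Literature.MathematicalPhysics.QuantumFieldTheory.Balaban1983to89.Beta.GradedBubbles (supNorm_neg)
open Summit.QuantumFields.BalabanUV.Beta.FP.ConstrainedGhost (ghostRem ghostRem_eq_tsum coarse_woodbury abs_blockSum_free_le summable_Ws
  summable_bdd_mul_Ws)
open Summit.QuantumFields.BalabanUV.Beta.FP.ConstrainedGhostIR (abs_ghostRem_le_of_letters abs_ghostRem_sub_le_of_letters)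
open Summit.QuantumFields.BalabanUV.Beta.FP.LatticeConvolutionBounds

variable {N : ℕ} [NeZero N]

/-! ## §1 Algebra of the letters' objects -/

omit [NeZero N] in
/-- [folklore] `#box = N⁴`. -/
theorem card_box_four : ((box (3 + 1) N).card : ℝ) = (N : ℝ) ^ 4 := by
  have : (box (3 + 1) N).card = N ^ 4 := by
    simp [AffineAveraging.box, Fintype.card_piFinset, Finset.card_range, Finset.prod_const, Finset.card_univ, Fintype.card_fin]
  rw [this]; push_cast; ring

omit [NeZero N] in
/-- [folklore] Evenness of the free leg: `blockSum N (G₀(· − x′)) v = blockSum N (G₀(x′ − ·)) v`. -/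
theorem blockSum_free_comm (x' v : AffineAveraging.Site (3 + 1)) :
    blockSum N (fun z => latticeGreen (z - x') / 2) v = blockSum N (fun z => latticeGreen (x' - z) / 2) v := by
  simp only [AffineAveraging.blockSum]
  refine Finset.sum_congr rfl fun b _ => ?_
  rw [← neg_sub x', latticeGreen_neg]

omit [NeZero N] in
/-- [folklore] **SYMMETRY OF THE COARSE OPERATOR** `M(v,w) = M(w,v)` (`G₀` is even). -/
theorem coarseM_symm (v w : AffineAveraging.Site (3 + 1)) :
    ∑ b ∈ box (3 + 1) N, blockSum N (fun z => latticeGreen ((N : ℤ) • v + toSite b - z) / 2) w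
      = ∑ b ∈ box (3 + 1) N, blockSum N (fun z => latticeGreen ((N : ℤ) • w + toSite b - z) / 2) v := by
  simp only [AffineAveraging.blockSum]
  rw [Finset.sum_comm]
  refine Finset.sum_congr rfl fun b _ => Finset.sum_congr rfl fun b' _ => ?_
  rw [← latticeGreen_neg]
  congr 1
  abel

omit [NeZero N] in
/-- [folklore] `M(w,v) = Σ_{b ∈ box} A(N•w + b, v)` read through the symmetry: `M(v, w) = Σ_b A(N•w + b, v)`. -/
theorem coarseM_eq_sum_col (v w : AffineAveraging.Site (3 + 1)) :
    ∑ b ∈ box (3 + 1) N, blockSum N (fun z => latticeGreen ((N : ℤ) • v + toSite b - z) / 2) w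
      = ∑ b ∈ box (3 + 1) N, blockSum N (fun z => latticeGreen ((N : ℤ) • w + toSite b - z) / 2) v :=
  coarseM_symm v w

omit [NeZero N] in
/-- [folklore] The coarse operator is bounded: `|M(v,w)| ≤ #box·(#box·G₀(0))`. -/
theorem abs_coarseM_le (v w : AffineAveraging.Site (3 + 1)) :
    |∑ b ∈ box (3 + 1) N, blockSum N (fun z => latticeGreen ((N : ℤ) • v + toSite b - z) / 2) w|
      ≤ (box (3 + 1) N).card * ((box (3 + 1) N).card * (latticeGreen (0 : AffineAveraging.Site (3 + 1)) / 2)) := by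
  refine (Finset.abs_sum_le_sum_abs _ _).trans ?_
  calc ∑ b ∈ box (3 + 1) N, |blockSum N (fun z => latticeGreen ((N : ℤ) • v + toSite b - z) / 2) w|
      ≤ ∑ _b ∈ box (3 + 1) N, ((box (3 + 1) N).card * (latticeGreen (0 : AffineAveraging.Site (3 + 1)) / 2)) :=
        Finset.sum_le_sum fun b _ => abs_blockSum_free_le (by norm_num) _ _
    _ = _ := by rw [Finset.sum_const, nsmul_eq_mul]

/-! ## §2 `W = −C·A`: the coarse Woodbury equation left-multiplied by the coarse inverse -/

/-- [folklore] **`Ws(u,x′) = −Σ'_v C(u,v)·A(x′,v)`** for any LEFT INVERSE `C` of the coarse operator with a summable (degree-5) row profile: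
`coarse_woodbury` (`A(x′,·) + M·W(·,x′) = 0`) left-multiplied by `C(u,·)` and Fubini (`|C|` summable in `v`, `M` bounded, `W(·,x′)` summable). -/
theorem Ws_eq_neg_tsum (C : AffineAveraging.Site (3 + 1) → AffineAveraging.Site (3 + 1) → ℝ) {κ : ℝ}
    (hC : ∀ u v, |C u v| ≤ κ / ((supNorm (u - v) : ℝ) + 1) ^ 5)
    (hCM : ∀ u w, HasSum (fun v => C u v * ∑ b ∈ box (3 + 1) N, blockSum N (fun z => latticeGreen ((N : ℤ) • v + toSite b - z) / 2) w)
      (if u = w then 1 else 0))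
    (u x' : AffineAveraging.Site (3 + 1)) :
    Ws (N := N) u x' = -∑' v, C u v * blockSum N (fun z => latticeGreen (x' - z) / 2) v := by
  -- the per-row identity from `coarse_woodbury`
  have hrow : ∀ v, blockSum N (fun z => latticeGreen (x' - z) / 2) v
      = -∑' y, (∑ b ∈ box (3 + 1) N, blockSum N (fun z => latticeGreen ((N : ℤ) • v + toSite b - z) / 2) y) * Ws (N := N) y x' := by
    intro v
    have h := coarse_woodbury (N := N) (d := 3) (by norm_num) x' v
    rw [blockSum_free_comm] at h
    linarith
  -- summability of the double family `(v, y) ↦ C(u,v)·M(v,y)·W(y,x′)`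
  set m₀ : ℝ := (box (3 + 1) N).card * ((box (3 + 1) N).card * (latticeGreen (0 : AffineAveraging.Site (3 + 1)) / 2)) with hm₀
  set F : AffineAveraging.Site (3 + 1) → AffineAveraging.Site (3 + 1) → ℝ := fun v y =>
    C u v * ((∑ b ∈ box (3 + 1) N, blockSum N (fun z => latticeGreen ((N : ℤ) • v + toSite b - z) / 2) y) * Ws (N := N) y x') with hF
  have hCsum : Summable fun v => κ / ((supNorm (v - u) : ℝ) + 1) ^ 5 := by
    have := (summable_inv_pow_sub (le_refl 5) u).mul_left κ
    refine this.congr fun v => ?_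
    rw [mul_one_div]
  have hWsum : Summable fun y => m₀ * |Ws (N := N) y x'| := (summable_Ws x').mul_left m₀
  have hκ : 0 ≤ κ := nonneg_of_abs_le_div (f := fun v => C u v) (p := u) (a := 5) u (hC u u)
  have hm₀nn : 0 ≤ m₀ := (abs_nonneg _).trans (abs_coarseM_le (N := N) u u)
  have hprod : Summable fun p : AffineAveraging.Site (3 + 1) × AffineAveraging.Site (3 + 1) =>
      κ / ((supNorm (p.1 - u) : ℝ) + 1) ^ 5 * (m₀ * |Ws (N := N) p.2 x'|) :=
    hCsum.mul_of_nonneg hWsum (fun v => div_nonneg hκ (by positivity)) (fun y => mul_nonneg hm₀nn (abs_nonneg _))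
  have hbound : ∀ p : AffineAveraging.Site (3 + 1) × AffineAveraging.Site (3 + 1),
      ‖Function.uncurry F p‖ ≤ κ / ((supNorm (p.1 - u) : ℝ) + 1) ^ 5 * (m₀ * |Ws (N := N) p.2 x'|) := by
    rintro ⟨v, y⟩
    simp only [Function.uncurry_apply_pair, hF, Real.norm_eq_abs, abs_mul]
    have h1 : |C u v| ≤ κ / ((supNorm (v - u) : ℝ) + 1) ^ 5 := by rw [← supNorm_neg, neg_sub]; exact hC u v
    have h2 := abs_coarseM_le (N := N) v y
    have h3 : 0 ≤ κ / ((supNorm (v - u) : ℝ) + 1) ^ 5 := div_nonneg hκ (by positivity)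
    exact mul_le_mul h1 (mul_le_mul_of_nonneg_right h2 (abs_nonneg _)) (by positivity) h3
  have hunc : Summable (Function.uncurry F) := Summable.of_norm_bounded hprod hbound
  -- Fubini
  have hswap : ∑' v, ∑' y, F v y = ∑' y, ∑' v, F v y := (Summable.tsum_comm hunc).symm
  -- left side: `Σ'_v C(u,v)·(−A(x′,v))`
  have hL : ∑' v, ∑' y, F v y = -∑' v, C u v * blockSum N (fun z => latticeGreen (x' - z) / 2) v := by
    rw [← tsum_neg]
    refine tsum_congr fun v => ?_
    rw [hrow v, mul_neg, neg_neg]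
    simp only [hF]
    exact tsum_mul_left
  -- right side: `Σ'_y [u = y]·W(y,x′) = W(u,x′)`
  have hR : ∑' y, ∑' v, F v y = Ws (N := N) u x' := by
    have hin : ∀ y, ∑' v, F v y = (if u = y then 1 else 0) * Ws (N := N) y x' := by
      intro y
      simp only [hF]
      rw [← (hCM u y).tsum_eq, ← tsum_mul_right]
      refine tsum_congr fun v => ?_
      ring
    rw [tsum_congr hin, tsum_eq_single u (fun y hy => by rw [if_neg (Ne.symm hy), zero_mul]), if_pos rfl, one_mul]
  rw [← hR, ← hswap, hL]

/-! ## §3 The cancellation: `W + δ∕N⁴ = −C·(A − block average of A)` has a degree-3 profile -/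

/-- [folklore] **THE WITHIN-BLOCK CANCELLATION**: with `u′ := quo N x′`,
`|Ws(u,x′) + [u = u′]∕N⁴| ≤ 1296·κ·a₂·N²∕(‖u − u′‖∞+1)³` — because `Σ'_v C(u,v)·M(v,u′) = [u = u′]` and `M(v,u′) = Σ_{b} A(N•u′ + b, v)` turn
`Ws + δ∕N⁴` into `−Σ'_v C(u,v)·[A(x′,v) − N⁻⁴Σ_b A(N•u′+b, v)]`, a block average of within-block DIFFERENCES (letter (L1′)), and a degree-5 kernel
reproduces the degree-3 profile (`tsum_kernel_profile_le`). -/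
theorem W_add_delta_bound (C : AffineAveraging.Site (3 + 1) → AffineAveraging.Site (3 + 1) → ℝ) {κ a₂ : ℝ} (hN : 1 ≤ N)
    (hC : ∀ u v, |C u v| ≤ κ / ((supNorm (u - v) : ℝ) + 1) ^ 5)
    (hCM : ∀ u w, HasSum (fun v => C u v * ∑ b ∈ box (3 + 1) N, blockSum N (fun z => latticeGreen ((N : ℤ) • v + toSite b - z) / 2) w)
      (if u = w then 1 else 0))
    (hAosc : ∀ x y v : AffineAveraging.Site (3 + 1), quo N x = quo N y →
      |blockSum N (fun z => latticeGreen (x - z) / 2) v - blockSum N (fun z => latticeGreen (y - z) / 2) v|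
        ≤ a₂ * (N : ℝ) ^ 2 / ((supNorm (quo N x - v) : ℝ) + 1) ^ 3)
    (u x' : AffineAveraging.Site (3 + 1)) :
    |Ws (N := N) u x' + (if u = quo N x' then 1 else 0) / (N : ℝ) ^ 4|
      ≤ 1296 * κ * (a₂ * (N : ℝ) ^ 2) / ((supNorm (u - quo N x') : ℝ) + 1) ^ 3 := by
  have hN0 : (0 : ℝ) < N := by exact_mod_cast hN
  have hN4 : (0 : ℝ) < (N : ℝ) ^ 4 := by positivity
  set u' := quo N x' with hu'
  set Acol : AffineAveraging.Site (3 + 1) → ℝ := fun v => blockSum N (fun z => latticeGreen (x' - z) / 2) v with hAcol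
  set Mcol : AffineAveraging.Site (3 + 1) → ℝ := fun v =>
    ∑ b ∈ box (3 + 1) N, blockSum N (fun z => latticeGreen ((N : ℤ) • v + toSite b - z) / 2) u' with hMcol
  set D : AffineAveraging.Site (3 + 1) → ℝ := fun v => Acol v - Mcol v / (N : ℝ) ^ 4 with hD
  -- the profile of `D`
  have hDle : ∀ v, |D v| ≤ a₂ * (N : ℝ) ^ 2 / ((supNorm (v - u') : ℝ) + 1) ^ 3 := by
    intro v
    have hMv : Mcol v = ∑ b ∈ box (3 + 1) N, blockSum N (fun z => latticeGreen ((N : ℤ) • u' + toSite b - z) / 2) v := by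
      rw [hMcol]; exact coarseM_eq_sum_col v u'
    have hcard := card_box_four (N := N)
    have e : D v = (∑ b ∈ box (3 + 1) N,
        (Acol v - blockSum N (fun z => latticeGreen ((N : ℤ) • u' + toSite b - z) / 2) v)) / (N : ℝ) ^ 4 := by
      simp only [hD]
      rw [hMv, Finset.sum_sub_distrib, Finset.sum_const, nsmul_eq_mul, hcard, sub_div, mul_div_cancel_left₀ _ hN4.ne']
    rw [e, abs_div, abs_of_pos hN4, div_le_iff₀ hN4]
    refine (Finset.abs_sum_le_sum_abs _ _).trans ?_
    have hterm : ∀ b ∈ box (3 + 1) N,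
        |Acol v - blockSum N (fun z => latticeGreen ((N : ℤ) • u' + toSite b - z) / 2) v|
          ≤ a₂ * (N : ℝ) ^ 2 / ((supNorm (v - u') : ℝ) + 1) ^ 3 := by
      intro b hb
      have hq : quo N x' = quo N ((N : ℤ) • u' + toSite b) := by rw [quo_zsmul_add_toSite (N := N) u' hb]
      have h := hAosc x' ((N : ℤ) • u' + toSite b) v hq
      rwa [← hu', ← supNorm_neg, neg_sub] at h
    calc ∑ b ∈ box (3 + 1) N, |Acol v - blockSum N (fun z => latticeGreen ((N : ℤ) • u' + toSite b - z) / 2) v|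
        ≤ ∑ _b ∈ box (3 + 1) N, a₂ * (N : ℝ) ^ 2 / ((supNorm (v - u') : ℝ) + 1) ^ 3 := Finset.sum_le_sum hterm
      _ = a₂ * (N : ℝ) ^ 2 / ((supNorm (v - u') : ℝ) + 1) ^ 3 * (N : ℝ) ^ 4 := by
          rw [Finset.sum_const, nsmul_eq_mul, hcard, mul_comm]
  -- the identity `Ws + δ/N⁴ = −Σ' C·D`
  have hCA : Summable fun v => C u v * Acol v := by
    have hA0 : ∀ v, |Acol v| ≤ ((box (3 + 1) N).card * (latticeGreen (0 : AffineAveraging.Site (3 + 1)) / 2))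
        / ((supNorm (v - u') : ℝ) + 1) ^ 0 := fun v => by
      rw [pow_zero, div_one]; exact abs_blockSum_free_le (by norm_num) _ _
    have hC' : ∀ v, |C u v| ≤ κ / ((supNorm (v - u) : ℝ) + 1) ^ 5 := fun v => by rw [← supNorm_neg, neg_sub]; exact hC u v
    exact (tsum_kernel_profile_le u u' (le_refl 5) (Nat.zero_le 5) hC' hA0).1
  have hCMsum : Summable fun v => C u v * Mcol v := (hCM u u').summable
  have hCD : Summable fun v => C u v * D v := by
    have : (fun v => C u v * D v) = fun v => C u v * Acol v - (C u v * Mcol v) / (N : ℝ) ^ 4 := by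
      funext v; simp only [hD]; ring
    rw [this]
    exact hCA.sub (hCMsum.div_const _)
  have hid : Ws (N := N) u x' + (if u = u' then 1 else 0) / (N : ℝ) ^ 4 = -∑' v, C u v * D v := by
    rw [Ws_eq_neg_tsum C hC hCM u x', ← (hCM u u').tsum_eq]
    have : ∑' v, C u v * D v = ∑' v, C u v * Acol v - (∑' v, C u v * Mcol v) / (N : ℝ) ^ 4 := by
      rw [← tsum_div_const, ← hCA.tsum_sub (hCMsum.div_const _)]
      refine tsum_congr fun v => ?_
      simp only [hD]; ring
    rw [this]
    ring
  rw [hid, abs_neg]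
  have hC' : ∀ v, |C u v| ≤ κ / ((supNorm (v - u) : ℝ) + 1) ^ 5 := fun v => by rw [← supNorm_neg, neg_sub]; exact hC u v
  have h := (tsum_kernel_profile_le u u' (le_refl 5) (by norm_num : 3 ≤ 5) hC' hDle).2
  refine h.trans ?_
  -- `κ·(a₂N²)·(162·(2/(m+2))³) ≤ 1296·κ·a₂N²/(m+1)³`
  have hκ : 0 ≤ κ := nonneg_of_abs_le_div (f := fun v => C u v) (p := u) (a := 5) u (hC u u)
  have ha₂ : 0 ≤ a₂ * (N : ℝ) ^ 2 := by
    have := nonneg_of_abs_le_div (f := D) u' (hDle u')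
    exact this
  have hm : (0 : ℝ) ≤ (supNorm (u - u') : ℝ) := Nat.cast_nonneg _
  rw [div_pow, show (2 : ℝ) ^ 3 = 8 by norm_num]
  have key : 162 * (8 / (((supNorm (u - u') : ℝ) + 2) ^ 3)) ≤ 1296 / ((supNorm (u - u') : ℝ) + 1) ^ 3 := by
    rw [mul_div_assoc', show (162 : ℝ) * 8 = 1296 by norm_num]
    apply div_le_div_of_nonneg_left (by norm_num) (by positivity)
    gcongr; norm_num
  calc κ * (a₂ * (N : ℝ) ^ 2) * (162 * (8 / ((supNorm (u - u') : ℝ) + 2) ^ 3))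
      ≤ κ * (a₂ * (N : ℝ) ^ 2) * (1296 / ((supNorm (u - u') : ℝ) + 1) ^ 3) := by gcongr
    _ = 1296 * κ * (a₂ * (N : ℝ) ^ 2) / ((supNorm (u - u') : ℝ) + 1) ^ 3 := by ring

/-! ## §4 leaf-06's (W) letter from (H-CINV) + (L1′) -/

/-- [folklore] **THE MULTIPLIER LETTER (W) FROM THE COARSE INVERSE**: `|Ws(y,x′)| ≤ (1296·κ·a₂·N⁶ + 1)·(N⁴)⁻¹·(‖y − quo N x′‖∞+1)⁻³` — leaf-06's hypothesis
`hW` of `ConstrainedGhostIR.abs_ghostRem_le_of_letters` with `b = 3` (the `+1` is the block-diagonal `δ∕N⁴`). -/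
theorem abs_Ws_le_of_coarseInv (C : AffineAveraging.Site (3 + 1) → AffineAveraging.Site (3 + 1) → ℝ) {κ a₂ : ℝ} (hN : 1 ≤ N)
    (hC : ∀ u v, |C u v| ≤ κ / ((supNorm (u - v) : ℝ) + 1) ^ 5)
    (hCM : ∀ u w, HasSum (fun v => C u v * ∑ b ∈ box (3 + 1) N, blockSum N (fun z => latticeGreen ((N : ℤ) • v + toSite b - z) / 2) w)
      (if u = w then 1 else 0))
    (hAosc : ∀ x y v : AffineAveraging.Site (3 + 1), quo N x = quo N y →
      |blockSum N (fun z => latticeGreen (x - z) / 2) v - blockSum N (fun z => latticeGreen (y - z) / 2) v|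
        ≤ a₂ * (N : ℝ) ^ 2 / ((supNorm (quo N x - v) : ℝ) + 1) ^ 3)
    (y x' : AffineAveraging.Site (3 + 1)) :
    |Ws (N := N) y x'| ≤ (1296 * κ * a₂ * (N : ℝ) ^ 6 + 1) * ((N : ℝ) ^ 4)⁻¹ * (((supNorm (y - quo N x') : ℝ) + 1) ^ 3)⁻¹ := by
  have hN0 : (0 : ℝ) < N := by exact_mod_cast hN
  have hN4 : (0 : ℝ) < (N : ℝ) ^ 4 := by positivity
  have h := W_add_delta_bound C hN hC hCM hAosc y x'
  set m : ℝ := (supNorm (y - quo N x') : ℝ) + 1 with hm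
  have hm1 : 1 ≤ m := one_le_supNorm_add_one _
  have hm0 : 0 < m := by linarith
  -- the two pieces
  have hκa : 0 ≤ 1296 * κ * (a₂ * (N : ℝ) ^ 2) := by
    have := (abs_nonneg _).trans h
    have hpos : (0 : ℝ) < m ^ 3 := by positivity
    rw [le_div_iff₀ hpos] at this
    nlinarith [abs_nonneg (Ws (N := N) y x' + (if y = quo N x' then 1 else 0) / (N : ℝ) ^ 4)]
  have hδ : |(if y = quo N x' then (1 : ℝ) else 0) / (N : ℝ) ^ 4| ≤ ((N : ℝ) ^ 4)⁻¹ * (m ^ 3)⁻¹ := by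
    split_ifs with hy
    · have : m = 1 := by rw [hm, hy, sub_self, (supNorm_eq_zero_iff).mpr rfl]; norm_num
      rw [this, one_pow, inv_one, mul_one, abs_of_nonneg (by positivity), one_div]
    · rw [zero_div, abs_zero]; positivity
  calc |Ws (N := N) y x'|
      = |(Ws (N := N) y x' + (if y = quo N x' then 1 else 0) / (N : ℝ) ^ 4) - (if y = quo N x' then 1 else 0) / (N : ℝ) ^ 4| := by
        rw [add_sub_cancel_right]
    _ ≤ |Ws (N := N) y x' + (if y = quo N x' then 1 else 0) / (N : ℝ) ^ 4| + |(if y = quo N x' then (1 : ℝ) else 0) / (N : ℝ) ^ 4| :=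
        abs_sub _ _
    _ ≤ 1296 * κ * (a₂ * (N : ℝ) ^ 2) / m ^ 3 + ((N : ℝ) ^ 4)⁻¹ * (m ^ 3)⁻¹ := add_le_add h hδ
    _ = (1296 * κ * a₂ * (N : ℝ) ^ 6 + 1) * ((N : ℝ) ^ 4)⁻¹ * (m ^ 3)⁻¹ := by
        field_simp

/-! ## §5 (T0)∕(T1) under (H-CINV), by leaf-06's letter interface -/

/-- [folklore] **(T0) UNDER (H-CINV)**: leaf-06's free-leg letter (S) + (L1′) + (H-CINV) ⟹ `|ghostRem N x x′| ≤ 162·A·(1296κa₂N⁶ + 1)·(N²)⁻¹` for ALL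
`x, x′` (`ConstrainedGhostIR.abs_ghostRem_le_of_letters` at the (W) letter of §4; with IR-4b's `κ = c₀N⁻⁶` the constant is `162·A·(1296c₀a₂ + 1)`,
N-FREE). -/
theorem abs_ghostRem_le_of_coarseInv (C : AffineAveraging.Site (3 + 1) → AffineAveraging.Site (3 + 1) → ℝ) {κ a₂ A : ℝ} (hN : 1 ≤ N)
    (hC : ∀ u v, |C u v| ≤ κ / ((supNorm (u - v) : ℝ) + 1) ^ 5)
    (hCM : ∀ u w, HasSum (fun v => C u v * ∑ b ∈ box (3 + 1) N, blockSum N (fun z => latticeGreen ((N : ℤ) • v + toSite b - z) / 2) w)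
      (if u = w then 1 else 0))
    (hAosc : ∀ x y v : AffineAveraging.Site (3 + 1), quo N x = quo N y →
      |blockSum N (fun z => latticeGreen (x - z) / 2) v - blockSum N (fun z => latticeGreen (y - z) / 2) v|
        ≤ a₂ * (N : ℝ) ^ 2 / ((supNorm (quo N x - v) : ℝ) + 1) ^ 3)
    (hS : ∀ x y : Pt, |blockSum N (fun z => latticeGreen (x - z) / 2) y| ≤ A * (N : ℝ) ^ 2 * (((supNorm (y - quo N x) : ℝ) + 1) ^ 2)⁻¹)
    (x x' : Pt) : |ghostRem (d := 3) N x x'| ≤ 162 * A * (1296 * κ * a₂ * (N : ℝ) ^ 6 + 1) * ((N : ℝ) ^ 2)⁻¹ :=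
  abs_ghostRem_le_of_letters (le_refl 3) hS (abs_Ws_le_of_coarseInv C hN hC hCM hAosc) x x'

/-- [folklore] **(T1) UNDER (H-CINV)**: leaf-06's difference letter (S′) for a shift `e` + (L1′) + (H-CINV) ⟹
`|ghostRem N (x + e) x′ − ghostRem N x x′| ≤ 162·A′·(1296κa₂N⁶ + 1)·(N³)⁻¹` for ALL `x, x′`. -/
theorem abs_ghostRem_sub_le_of_coarseInv (C : AffineAveraging.Site (3 + 1) → AffineAveraging.Site (3 + 1) → ℝ) {κ a₂ A' : ℝ} (hN : 1 ≤ N)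
    (hC : ∀ u v, |C u v| ≤ κ / ((supNorm (u - v) : ℝ) + 1) ^ 5)
    (hCM : ∀ u w, HasSum (fun v => C u v * ∑ b ∈ box (3 + 1) N, blockSum N (fun z => latticeGreen ((N : ℤ) • v + toSite b - z) / 2) w)
      (if u = w then 1 else 0))
    (hAosc : ∀ x y v : AffineAveraging.Site (3 + 1), quo N x = quo N y →
      |blockSum N (fun z => latticeGreen (x - z) / 2) v - blockSum N (fun z => latticeGreen (y - z) / 2) v|
        ≤ a₂ * (N : ℝ) ^ 2 / ((supNorm (quo N x - v) : ℝ) + 1) ^ 3)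
    (e : Pt)
    (hS' : ∀ x y : Pt, |blockSum N (fun z => latticeGreen (x + e - z) / 2) y - blockSum N (fun z => latticeGreen (x - z) / 2) y|
      ≤ A' * (N : ℝ) * (((supNorm (y - quo N x) : ℝ) + 1) ^ 3)⁻¹)
    (x x' : Pt) :
    |ghostRem (d := 3) N (x + e) x' - ghostRem (d := 3) N x x'| ≤ 162 * A' * (1296 * κ * a₂ * (N : ℝ) ^ 6 + 1) * ((N : ℝ) ^ 3)⁻¹ :=
  abs_ghostRem_sub_le_of_letters (le_refl 3) e hS' (abs_Ws_le_of_coarseInv C hN hC hCM hAosc) x x'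

/-! ## §6 The exponential form of (H-CINV) (the owner's `CoarseInverseScalar` (C1) currency) -/

/-- [folklore] An exponentially local coarse kernel `|C u v| ≤ c·e^{−δ‖u−v‖∞}` (`0 < δ`, `0 ≤ c`) satisfies the polynomial letter of this file with
`κ = c·e^δ·5!∕δ⁵` (`LatticeConvolutionBounds.exp_neg_supNorm_le_div_pow`). -/
theorem coarseInv_poly_of_exp {C : AffineAveraging.Site (3 + 1) → AffineAveraging.Site (3 + 1) → ℝ} {c δ : ℝ} (hδ : 0 < δ) (hc : 0 ≤ c)
    (hC : ∀ u v, |C u v| ≤ c * Real.exp (-(δ * supNorm (u - v)))) (u v : AffineAveraging.Site (3 + 1)) :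
    |C u v| ≤ (c * (Real.exp δ * (Nat.factorial 5) / δ ^ 5)) / ((supNorm (u - v) : ℝ) + 1) ^ 5 :=
  (hC u v).trans (exp_neg_supNorm_le_div_pow hδ hc 5 (u - v))

/-- [folklore] **(T0) FROM THE EXPONENTIAL COARSE LETTER** `|C u v| ≤ c₀N⁻⁶·e^{−δ‖u−v‖∞}` (IR-4b's (C1)): `|ghostRem N x x′| ≤ 162·A·(1296·(c₀·e^δ·5!∕δ⁵)·a₂ + 1)·(N²)⁻¹`
— the constant is FREE of `N`. -/
theorem abs_ghostRem_le_of_coarseInv_exp (C : AffineAveraging.Site (3 + 1) → AffineAveraging.Site (3 + 1) → ℝ) {c₀ δ a₂ A : ℝ} (hN : 1 ≤ N)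
    (hδ : 0 < δ) (hc₀ : 0 ≤ c₀)
    (hC : ∀ u v, |C u v| ≤ c₀ / (N : ℝ) ^ 6 * Real.exp (-(δ * supNorm (u - v))))
    (hCM : ∀ u w, HasSum (fun v => C u v * ∑ b ∈ box (3 + 1) N, blockSum N (fun z => latticeGreen ((N : ℤ) • v + toSite b - z) / 2) w)
      (if u = w then 1 else 0))
    (hAosc : ∀ x y v : AffineAveraging.Site (3 + 1), quo N x = quo N y →
      |blockSum N (fun z => latticeGreen (x - z) / 2) v - blockSum N (fun z => latticeGreen (y - z) / 2) v|
        ≤ a₂ * (N : ℝ) ^ 2 / ((supNorm (quo N x - v) : ℝ) + 1) ^ 3)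
    (hS : ∀ x y : Pt, |blockSum N (fun z => latticeGreen (x - z) / 2) y| ≤ A * (N : ℝ) ^ 2 * (((supNorm (y - quo N x) : ℝ) + 1) ^ 2)⁻¹)
    (x x' : Pt) :
    |ghostRem (d := 3) N x x'| ≤ 162 * A * (1296 * (c₀ * (Real.exp δ * (Nat.factorial 5) / δ ^ 5)) * a₂ + 1) * ((N : ℝ) ^ 2)⁻¹ := by
  have hN0 : (0 : ℝ) < N := by exact_mod_cast hN
  have hc : 0 ≤ c₀ / (N : ℝ) ^ 6 := by positivity
  have hCp := coarseInv_poly_of_exp hδ hc hC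
  have h := abs_ghostRem_le_of_coarseInv C hN hCp hCM hAosc hS x x'
  refine h.trans (le_of_eq ?_)
  field_simp

end Summit.QuantumFields.BalabanUV.Beta.FP.ConstrainedGhostIRCoarse
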